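import Mathlib
import HarnessLib
import Summits.Ventures.LatticeQCDFlow.Exactness.LatticeSiteLocality
import Summits.Ventures.LatticeQCDFlow.Exactness.SphereNLOFlowGenerator

/-!
# Locality of Lüscher's flow-action series on the lattice of site spheres: the order-`k` term is a sum of local polynomials whose footprint grows linearly in `k`

HONEST FRAMING: exact (Metropolis-corrected) sampling algorithms for lattice gauge theory;
figures of merit are autocorrelation/cost numbers at stated couplings and volumes; no
continuum-physics claim.

Venture `LatticeQCDFlow` (cell pub-lqcd), topic `Exactness`; FANOUT row 7 (`s0-cpn-null`).  NEW
WORK of the cell over Mathlib and the tree's `Exactness/LatticeSiteLocality.lean` (`sdepOn`,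
`polySD`, support bookkeeping of the site operators and of the carré du champ),
`Exactness/SphereLuscherSeriesExistence.lean` (`latticeCarre`, `sum_inner_siteGrad_eq_latticeCarre`)
and `Exactness/SphereLatticePoissonSolver.lean` (GEN-8: the Poisson solver in a finite-dimensional
stable space); nothing is cited as a fact.  Sphere-model counterpart of theory-1's gauge-side
`TrivializingMaps/LuscherSeriesExistence.lean` (`luscherFootprintLinear_holds`: the order-`k`
Wilson-flow action is a local sum of range `1 + k`).  Printed counterpart, NAMED ONLY: M. Lüscher,
Commun. Math. Phys. 293 (2010) 899, §4.4–§4.5 (each order of the flow action of the Wilson flow is a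
linear combination of loops whose extension grows with the order — the perturbative trivializing
map is local order by order, with a footprint linear in the order); Engel–Schaefer, Comput. Phys.
Commun. 182 (2011) 2107, §3 (order `0` for CP(N−1): `S̃⁽⁰⁾ ∝ S` is nearest-neighbour).

## Content (`E` finite-dimensional real inner product space, `dim E ≥ 2`; `Λ` finite nonempty)

* §1 `nball N r n` — the radius-`r` ball of site `n` for a neighbourhood structure `N : Λ → Set Λ`
  (`nball 0 n = {n}`, `nball (r+1) n = nball r n ∪ ⋃_{m ∈ nball r n} N m`); monotonicity and the
  triangle inclusion `nball_subset_nball_add` (`m ∈ nball r n ⇒ nball s m ⊆ nball (r+s) n`).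
* §2 `LocalAction` — the data of a LOCAL POLYNOMIAL ACTION `S = Σ_n s_n`: parts `s_n` of degree
  `≤ a` supported in `nball N 1 n`, with site gradients `D_k S`, `E_k S` supported in `nball N 1 k`
  (the Engel–Schaefer action is an instance: sequel `Exactness/SphereLuscherSeriesLocalityES.lean`);
  **`LocalAction.source_mem`** — if `X` is a polynomial of degree `≤ M` supported in `nball N r n`
  then the next source `−Σ_m ⟨∂̃_m S, ∂̃_m X⟩` (ambient form `−latticeCarre S X`) is a polynomial of
  degree `≤ a + M` supported in `nball N (r+1) n`.
* §3 THE LOCAL RECURSION: `localRec`/`localTerm` (anchor by anchor: `X_n⁽⁰⁾` solves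
  `−Σ∂̃² X = s_n + c` in `polySD a (nball 1 n)`, `X_n⁽ᵏ⁺¹⁾` solves
  `−Σ∂̃² X = −latticeCarre S X_n⁽ᵏ⁾ + c` in `polySD (a(k+2)) (nball (k+2) n)`),
  **`localTerm_mem`** (`X_n⁽ᵏ⁾ ∈ polySD (a(k+1)) (nball (k+1) n)`: LINEAR FOOTPRINT GROWTH),
  **`localSeries_zero_eq`**, **`localSeries_succ_eq`** (the assembled sums `S̃⁽ᵏ⁾ = Σ_n X_n⁽ᵏ⁾`
  solve Lüscher's recursion for `S`), **`exists_local_luscher_series`** — FOR EVERY LOCAL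
  POLYNOMIAL ACTION THERE IS A LÜSCHER SERIES WHOSE ORDER-`k` TERM IS A SUM OVER SITES OF
  POLYNOMIALS OF DEGREE `≤ a(k+1)` SUPPORTED IN BALLS OF RADIUS `k+1`.  By
  `SphereLuscherSeriesUniqueness.luscher_series_unique` every other `C²` series agrees with it
  order by order up to additive constants on the spheres.

NOT CLAIMED: anything at `t > 0` / convergence; optimality of the radius `k+1`; bounds on the
coefficients (no norms are estimated); anything quantitative.
-/

noncomputable section

namespace Summit.Ventures.LatticeQCDFlow.Exactness

open Function Set NormedSpace InnerProductSpace Metric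
open scoped RealInnerProductSpace ContDiff

variable {Λ : Type*} {E : Type*} [NormedAddCommGroup E] [InnerProductSpace ℝ E]

/-! ## §1 Balls of a neighbourhood structure -/

section Balls

/-- **`nball N r n`**: the radius-`r` ball of `n` for the neighbourhood structure `N`. -/
def nball (N : Λ → Set Λ) : ℕ → Λ → Set Λ
  | 0, n => {n}
  | r + 1, n => nball N r n ∪ ⋃ m ∈ nball N r n, N m

variable {N : Λ → Set Λ}

/-- The radius-`0` ball is the site itself. -/
@[simp] theorem mem_nball_zero {m n : Λ} : m ∈ nball N 0 n ↔ m = n := Iff.rfl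

/-- Unfolding the successor ball. -/
theorem nball_succ (r : ℕ) (n : Λ) : nball N (r + 1) n = nball N r n ∪ ⋃ m ∈ nball N r n, N m := rfl

/-- Balls grow with the radius (one step). -/
theorem nball_subset_succ (r : ℕ) (n : Λ) : nball N r n ⊆ nball N (r + 1) n :=
  subset_union_left

/-- Balls grow with the radius. -/
theorem nball_mono {r r' : ℕ} (h : r ≤ r') (n : Λ) : nball N r n ⊆ nball N r' n := by
  induction h with
  | refl => exact Subset.rfl
  | step _ ih => exact ih.trans (nball_subset_succ _ n)

/-- Every ball contains its centre. -/
theorem self_mem_nball (r : ℕ) (n : Λ) : n ∈ nball N r n :=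
  nball_mono (Nat.zero_le r) n (mem_nball_zero.2 rfl)

/-- The neighbourhood of a point of the radius-`r` ball lies in the radius-`(r+1)` ball. -/
theorem subset_nball_succ_of_mem {r : ℕ} {n m : Λ} (hm : m ∈ nball N r n) :
    N m ⊆ nball N (r + 1) n :=
  fun _ hm' => Or.inr (mem_iUnion₂.2 ⟨m, hm, hm'⟩)

/-- The neighbourhood of the centre lies in the radius-`1` ball. -/
theorem subset_nball_one (n : Λ) : N n ⊆ nball N 1 n :=
  subset_nball_succ_of_mem (mem_nball_zero.2 rfl)

/-- **Triangle inclusion**: a ball of radius `s` about a point of the radius-`r` ball of `n` lies in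
the radius-`(r+s)` ball of `n`. -/
theorem nball_subset_nball_add {r : ℕ} {n m : Λ} (hm : m ∈ nball N r n) :
    ∀ s : ℕ, nball N s m ⊆ nball N (r + s) n
  | 0 => fun m' hm' => by rw [mem_nball_zero.1 hm']; exact hm
  | s + 1 => by
      rintro _ (hm' | hm')
      · exact nball_subset_succ _ n (nball_subset_nball_add hm s hm')
      · obtain ⟨m'', hm'', hm'''⟩ := mem_iUnion₂.1 hm'
        exact subset_nball_succ_of_mem (nball_subset_nball_add hm s hm'') hm'''

end Balls

/-! ## §2 Local polynomial actions and the support of the next source -/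

section LocalActionData

variable [FiniteDimensional ℝ E] [Fintype Λ] [DecidableEq Λ]

variable (Λ E) in
/-- **A local polynomial action** `S = Σ_n s_n` on `Λ → E`: parts of degree `≤ deg` supported in the
radius-`1` balls, whose total site gradients `D_k S · b_i`, `E_k S` are supported in `nball N 1 k`. -/
structure LocalAction where
  /-- the neighbourhood structure -/
  N : Λ → Set Λ
  /-- the polynomial degree of the parts -/
  deg : ℕ
  /-- the local parts `s_n` -/
  part : Λ → (Λ → E) → ℝ
  /-- each part is a polynomial of degree `≤ deg` supported in `nball N 1 n` -/
  part_mem : ∀ n, part n ∈ polySD Λ E deg (nball N 1 n)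
  /-- the site derivatives of the total action are supported near the site -/
  siteDeriv_mem : ∀ k i, siteDeriv k (stdOrthonormalBasis ℝ E i) (fun x => ∑ n, part n x) ∈
    sdepOn (nball N 1 k)
  /-- the Euler terms of the total action are supported near the site -/
  siteEuler_mem : ∀ k, siteEuler k (fun x => ∑ n, part n x) ∈ sdepOn (nball N 1 k)

/-- The total action `S = Σ_n s_n` of a local polynomial action. -/
def LocalAction.action (D : LocalAction Λ E) : (Λ → E) → ℝ := fun x => ∑ n, D.part n x

/-- The total action is a lattice polynomial of degree `≤ deg`. -/
theorem LocalAction.action_mem (D : LocalAction Λ E) : D.action ∈ polyS Λ E D.deg := by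
  have e : D.action = ∑ n, D.part n := by
    funext x; simp only [LocalAction.action, Finset.sum_apply]
  rw [e]
  exact Submodule.sum_mem _ fun n _ => (D.part_mem n).1

/-- **Support of the next source**: if `X` is a polynomial of degree `≤ M` supported in
`nball N r n`, then `−latticeCarre S X` (= `−Σ_m ⟨∂̃_m S, ∂̃_m X⟩` on the spheres) is a polynomial
of degree `≤ deg + M` supported in `nball N (r+1) n`. -/
theorem LocalAction.source_mem (D : LocalAction Λ E) {M r : ℕ} {n : Λ} {X : (Λ → E) → ℝ}
    (hX : X ∈ polySD Λ E M (nball D.N r n)) :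
    (fun x => -latticeCarre D.action X x) ∈ polySD Λ E (D.deg + M) (nball D.N (r + 1) n) := by
  refine ⟨neg_latticeCarre_mem_polyS D.action_mem hX.1, ?_⟩
  have e : (fun x => -latticeCarre D.action X x) = -∑ m, ambCarre m D.action X := by
    funext x; simp only [latticeCarre, Pi.neg_apply, Finset.sum_apply]
  rw [e]
  refine Submodule.neg_mem _ (Submodule.sum_mem _ fun m _ => ?_)
  by_cases hm : m ∈ nball D.N r n
  · have hsub : nball D.N 1 m ⊆ nball D.N (r + 1) n := nball_subset_nball_add hm 1
    exact ambCarre_mem_sdepOn (fun i => sdepOn_mono hsub (D.siteDeriv_mem m i))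
      (sdepOn_mono hsub (D.siteEuler_mem m)) (sdepOn_mono (nball_subset_succ r n) hX.2)
  · rw [ambCarre_eq_zero_of_not_mem hX.2 hm]
    exact Submodule.zero_mem _

end LocalActionData

/-! ## §3 The local recursion and linear footprint growth -/

section LocalRecursion

variable [FiniteDimensional ℝ E] [MeasurableSpace E] [BorelSpace E] [Fintype Λ] [DecidableEq Λ]
  [Nonempty Λ]

/-- **The local Poisson solver**: for `R ∈ polySD N A` there are `X ∈ polySD N A` and a constant `c`
with `−Σ_k ∂̃_k·∂̃_k X = R + c` on the product of unit spheres. -/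
theorem exists_polySD_poisson (h2 : 2 ≤ Module.finrank ℝ E) {N : ℕ} {A : Set Λ}
    {R : (Λ → E) → ℝ} (hR : R ∈ polySD Λ E N A) :
    ∃ X : polySD Λ E N A, ∃ c : ℝ, ∀ ξ : Λ → sphere (0 : E) 1,
      -∑ k, siteLaplacian k (X : (Λ → E) → ℝ) (fun n => (ξ n : E)) = R (fun n => (ξ n : E)) + c := by
  obtain ⟨X, hXP, c, hc⟩ := exists_luscher_poisson_solution h2 (polySD_contDiff_two N A)
    (polySD_siteLaplacian_stable N A) (const_mem_polySD N A 1) hR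
  exact ⟨⟨X, hXP⟩, c, hc⟩

/-- A chosen local solution. -/
def solvePD (h2 : 2 ≤ Module.finrank ℝ E) {N : ℕ} {A : Set Λ} {R : (Λ → E) → ℝ}
    (hR : R ∈ polySD Λ E N A) : polySD Λ E N A :=
  Classical.choose (exists_polySD_poisson h2 hR)

/-- The defining property of `solvePD`. -/
theorem solvePD_spec (h2 : 2 ≤ Module.finrank ℝ E) {N : ℕ} {A : Set Λ} {R : (Λ → E) → ℝ}
    (hR : R ∈ polySD Λ E N A) : ∃ c : ℝ, ∀ ξ : Λ → sphere (0 : E) 1,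
      -∑ k, siteLaplacian k (solvePD h2 hR : (Λ → E) → ℝ) (fun n => (ξ n : E)) =
        R (fun n => (ξ n : E)) + c :=
  Classical.choose_spec (exists_polySD_poisson h2 hR)

/-- **The local recursion anchored at `n`**, carrying (degree, radius). -/
def localRec (h2 : 2 ≤ Module.finrank ℝ E) (D : LocalAction Λ E) (n : Λ) :
    ℕ → Σ p : ℕ × ℕ, polySD Λ E p.1 (nball D.N p.2 n)
  | 0 => ⟨(D.deg, 1), solvePD h2 (D.part_mem n)⟩
  | k + 1 => ⟨(D.deg + (localRec h2 D n k).1.1, (localRec h2 D n k).1.2 + 1),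
      solvePD h2 (D.source_mem (localRec h2 D n k).2.2)⟩

/-- The carried radius at order `k` is `k + 1`. -/
theorem localRec_radius (h2 : 2 ≤ Module.finrank ℝ E) (D : LocalAction Λ E) (n : Λ) :
    ∀ k, (localRec h2 D n k).1.2 = k + 1
  | 0 => rfl
  | k + 1 => by
      show (localRec h2 D n k).1.2 + 1 = k + 1 + 1
      rw [localRec_radius h2 D n k]

/-- The carried degree at order `k` is `deg·(k+1)`. -/
theorem localRec_degree (h2 : 2 ≤ Module.finrank ℝ E) (D : LocalAction Λ E) (n : Λ) :
    ∀ k, (localRec h2 D n k).1.1 = D.deg * (k + 1)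
  | 0 => by show D.deg = D.deg * (0 + 1); ring
  | k + 1 => by
      show D.deg + (localRec h2 D n k).1.1 = D.deg * (k + 1 + 1)
      rw [localRec_degree h2 D n k]; ring

/-- **The order-`k` local term anchored at `n`**, `X_n⁽ᵏ⁾`. -/
def localTerm (h2 : 2 ≤ Module.finrank ℝ E) (D : LocalAction Λ E) (k : ℕ) (n : Λ) :
    (Λ → E) → ℝ :=
  ((localRec h2 D n k).2 : (Λ → E) → ℝ)

/-- **LINEAR FOOTPRINT GROWTH**: `X_n⁽ᵏ⁾` is a lattice polynomial of degree `≤ deg·(k+1)` supported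
in the radius-`(k+1)` ball of its anchor. -/
theorem localTerm_mem (h2 : 2 ≤ Module.finrank ℝ E) (D : LocalAction Λ E) (k : ℕ) (n : Λ) :
    localTerm h2 D k n ∈ polySD Λ E (D.deg * (k + 1)) (nball D.N (k + 1) n) :=
  polySD_mono (le_of_eq (localRec_degree h2 D n k))
    (fun m hm => by rwa [localRec_radius h2 D n k] at hm) (localRec h2 D n k).2.2

/-- The local solution property of `X_n⁽⁰⁾`: `−Σ∂̃² X_n⁽⁰⁾ = s_n + c` on the spheres. -/
theorem localTerm_zero_spec (h2 : 2 ≤ Module.finrank ℝ E) (D : LocalAction Λ E) (n : Λ) :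
    ∃ c : ℝ, ∀ ξ : Λ → sphere (0 : E) 1,
      -∑ j, siteLaplacian j (localTerm h2 D 0 n) (fun m => (ξ m : E)) =
        D.part n (fun m => (ξ m : E)) + c :=
  solvePD_spec h2 (D.part_mem n)

/-- The local solution property of `X_n⁽ᵏ⁺¹⁾`: `−Σ∂̃² X_n⁽ᵏ⁺¹⁾ = −latticeCarre S X_n⁽ᵏ⁾ + c`. -/
theorem localTerm_succ_spec (h2 : 2 ≤ Module.finrank ℝ E) (D : LocalAction Λ E) (k : ℕ) (n : Λ) :
    ∃ c : ℝ, ∀ ξ : Λ → sphere (0 : E) 1,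
      -∑ j, siteLaplacian j (localTerm h2 D (k + 1) n) (fun m => (ξ m : E)) =
        -latticeCarre D.action (localTerm h2 D k n) (fun m => (ξ m : E)) + c :=
  solvePD_spec h2 (D.source_mem (localRec h2 D n k).2.2)

omit [MeasurableSpace E] [BorelSpace E] [Nonempty Λ] in
/-- Site sections of lattice polynomials are `C^m`. -/
theorem contDiff_section_of_mem_polyS {M : ℕ} {F : (Λ → E) → ℝ} (hF : F ∈ polyS Λ E M)
    (x : Λ → E) (k : Λ) (m : ℕ) : ContDiff ℝ m (fun y => F (update x k y)) :=
  contDiff_infty.1 ((contDiff_of_mem_polyS hF).comp (contDiff_update ∞ x k)) m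

omit [MeasurableSpace E] [BorelSpace E] [Nonempty Λ] in
/-- `−Σ_j ∂̃_j·∂̃_j` of a finite sum of lattice polynomials, on the spheres, is the sum. -/
theorem neg_sum_siteLaplacian_sum {ι : Type*} (s : Finset ι) {M : ι → ℕ} {G : ι → (Λ → E) → ℝ}
    (hG : ∀ i ∈ s, G i ∈ polyS Λ E (M i)) (ξ : Λ → sphere (0 : E) 1) :
    -∑ j, siteLaplacian j (fun x => ∑ i ∈ s, G i x) (fun n => (ξ n : E)) =
      ∑ i ∈ s, -∑ j, siteLaplacian j (G i) (fun n => (ξ n : E)) := by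
  have h : ∀ j, siteLaplacian j (fun x => ∑ i ∈ s, G i x) (fun n => (ξ n : E)) =
      ∑ i ∈ s, siteLaplacian j (G i) (fun n => (ξ n : E)) := fun j =>
    siteLaplacian_finset_sum s (sphereConfig_ne_zero ξ j)
      fun i hi => contDiff_section_of_mem_polyS (hG i hi) _ j 2
  rw [Finset.sum_congr rfl fun j _ => h j, Finset.sum_comm, Finset.sum_neg_distrib]

omit [MeasurableSpace E] [BorelSpace E] [Nonempty Λ] in
/-- `∂̃_j` of a finite sum of lattice polynomials, on the spheres, is the sum. -/
theorem siteGrad_sum {ι : Type*} (s : Finset ι) {M : ι → ℕ} {G : ι → (Λ → E) → ℝ}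
    (hG : ∀ i ∈ s, G i ∈ polyS Λ E (M i)) (ξ : Λ → sphere (0 : E) 1) (j : Λ) :
    siteGrad j (fun x => ∑ i ∈ s, G i x) (fun n => (ξ n : E)) =
      ∑ i ∈ s, siteGrad j (G i) (fun n => (ξ n : E)) :=
  siteGrad_finset_sum s (sphereConfig_ne_zero ξ j)
    fun i hi => contDiff_section_of_mem_polyS (hG i hi) _ j 1

/-- **Order `0` of the assembled series**: `−Σ_j ∂̃_j·∂̃_j S̃⁽⁰⁾ = S + ċ₀` on the spheres. -/
theorem localSeries_zero_eq (h2 : 2 ≤ Module.finrank ℝ E) (D : LocalAction Λ E) :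
    ∃ c : ℝ, ∀ ξ : Λ → sphere (0 : E) 1,
      -∑ j, siteLaplacian j (fun x => ∑ n, localTerm h2 D 0 n x) (fun m => (ξ m : E)) =
        D.action (fun m => (ξ m : E)) + c := by
  refine ⟨∑ n, Classical.choose (localTerm_zero_spec h2 D n), fun ξ => ?_⟩
  calc -∑ j, siteLaplacian j (fun x => ∑ n, localTerm h2 D 0 n x) (fun m => (ξ m : E))
      = ∑ n, -∑ j, siteLaplacian j (localTerm h2 D 0 n) (fun m => (ξ m : E)) :=
        neg_sum_siteLaplacian_sum Finset.univ (fun n _ => (localTerm_mem h2 D 0 n).1) ξ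
    _ = ∑ n, (D.part n (fun m => (ξ m : E)) + Classical.choose (localTerm_zero_spec h2 D n)) :=
        Finset.sum_congr rfl fun n _ => Classical.choose_spec (localTerm_zero_spec h2 D n) ξ
    _ = D.action (fun m => (ξ m : E)) + ∑ n, Classical.choose (localTerm_zero_spec h2 D n) := by
        rw [Finset.sum_add_distrib]; rfl

/-- **Order `k+1` of the assembled series**:
`−Σ_j ∂̃_j·∂̃_j S̃⁽ᵏ⁺¹⁾ = −Σ_j ⟪∂̃_j S, ∂̃_j S̃⁽ᵏ⁾⟫ + ċ_{k+1}` on the spheres. -/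
theorem localSeries_succ_eq (h2 : 2 ≤ Module.finrank ℝ E) (D : LocalAction Λ E) (k : ℕ) :
    ∃ c : ℝ, ∀ ξ : Λ → sphere (0 : E) 1,
      -∑ j, siteLaplacian j (fun x => ∑ n, localTerm h2 D (k + 1) n x) (fun m => (ξ m : E)) =
        -(∑ j, ⟪siteGrad j D.action (fun m => (ξ m : E)),
            siteGrad j (fun x => ∑ n, localTerm h2 D k n x) (fun m => (ξ m : E))⟫) + c := by
  refine ⟨∑ n, Classical.choose (localTerm_succ_spec h2 D k n), fun ξ => ?_⟩
  have hX : ∀ n, -∑ j, siteLaplacian j (localTerm h2 D (k + 1) n) (fun m => (ξ m : E)) =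
      -(∑ j, ⟪siteGrad j D.action (fun m => (ξ m : E)),
          siteGrad j (localTerm h2 D k n) (fun m => (ξ m : E))⟫) +
        Classical.choose (localTerm_succ_spec h2 D k n) := fun n => by
    rw [sum_inner_siteGrad_eq_latticeCarre (contDiff_of_mem_polyS D.action_mem)
      (contDiff_of_mem_polyS (localTerm_mem h2 D k n).1) fun m => by simp]
    exact Classical.choose_spec (localTerm_succ_spec h2 D k n) ξ
  have hG : ∀ j, siteGrad j (fun x => ∑ n, localTerm h2 D k n x) (fun m => (ξ m : E)) =
      ∑ n, siteGrad j (localTerm h2 D k n) (fun m => (ξ m : E)) := fun j =>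
    siteGrad_sum Finset.univ (fun n _ => (localTerm_mem h2 D k n).1) ξ j
  calc -∑ j, siteLaplacian j (fun x => ∑ n, localTerm h2 D (k + 1) n x) (fun m => (ξ m : E))
      = ∑ n, -∑ j, siteLaplacian j (localTerm h2 D (k + 1) n) (fun m => (ξ m : E)) :=
        neg_sum_siteLaplacian_sum Finset.univ (fun n _ => (localTerm_mem h2 D (k + 1) n).1) ξ
    _ = ∑ n, (-(∑ j, ⟪siteGrad j D.action (fun m => (ξ m : E)),
          siteGrad j (localTerm h2 D k n) (fun m => (ξ m : E))⟫) +
            Classical.choose (localTerm_succ_spec h2 D k n)) :=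
        Finset.sum_congr rfl fun n _ => hX n
    _ = -(∑ j, ∑ n, ⟪siteGrad j D.action (fun m => (ξ m : E)),
          siteGrad j (localTerm h2 D k n) (fun m => (ξ m : E))⟫) +
            ∑ n, Classical.choose (localTerm_succ_spec h2 D k n) := by
        rw [Finset.sum_add_distrib, Finset.sum_neg_distrib, Finset.sum_comm]
    _ = -(∑ j, ⟪siteGrad j D.action (fun m => (ξ m : E)),
          siteGrad j (fun x => ∑ n, localTerm h2 D k n x) (fun m => (ξ m : E))⟫) +
            ∑ n, Classical.choose (localTerm_succ_spec h2 D k n) := by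
        congr 2
        exact Finset.sum_congr rfl fun j _ => by rw [hG j, inner_sum]

/-- **LÜSCHER'S SERIES OF A LOCAL POLYNOMIAL ACTION IS LOCAL, WITH FOOTPRINT LINEAR IN THE ORDER.**
For every local polynomial action `S = Σ_n s_n` (parts of degree `≤ a` in the radius-`1` balls of a
neighbourhood structure `N`, site gradients of `S` in the radius-`1` balls; `dim E ≥ 2`), there are
functionals `X_n⁽ᵏ⁾` — LATTICE POLYNOMIALS OF DEGREE `≤ a(k+1)` SUPPORTED IN `nball N (k+1) n` — and
constants `ċ_k` such that `S̃⁽ᵏ⁾ = Σ_n X_n⁽ᵏ⁾` solves Lüscher's recursion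
`−Σ∂̃²S̃⁽⁰⁾ = S + ċ₀`, `−Σ∂̃²S̃⁽ᵏ⁺¹⁾ = −Σ⟪∂̃S, ∂̃S̃⁽ᵏ⁾⟫ + ċ_{k+1}` on the product of unit spheres. -/
theorem exists_local_luscher_series (h2 : 2 ≤ Module.finrank ℝ E) (D : LocalAction Λ E) :
    ∃ (X : ℕ → Λ → (Λ → E) → ℝ) (c : ℕ → ℝ),
      (∀ k n, X k n ∈ polySD Λ E (D.deg * (k + 1)) (nball D.N (k + 1) n)) ∧
      (∀ ξ : Λ → sphere (0 : E) 1,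
        -∑ j, siteLaplacian j (fun x => ∑ n, X 0 n x) (fun m => (ξ m : E)) =
          D.action (fun m => (ξ m : E)) + c 0) ∧
      (∀ k, ∀ ξ : Λ → sphere (0 : E) 1,
        -∑ j, siteLaplacian j (fun x => ∑ n, X (k + 1) n x) (fun m => (ξ m : E)) =
          -(∑ j, ⟪siteGrad j D.action (fun m => (ξ m : E)),
              siteGrad j (fun x => ∑ n, X k n x) (fun m => (ξ m : E))⟫) + c (k + 1)) := by
  refine ⟨localTerm h2 D, fun k => Nat.casesOn k (Classical.choose (localSeries_zero_eq h2 D))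
    fun j => Classical.choose (localSeries_succ_eq h2 D j), localTerm_mem h2 D, fun ξ => ?_,
    fun k ξ => ?_⟩
  · exact Classical.choose_spec (localSeries_zero_eq h2 D) ξ
  · exact Classical.choose_spec (localSeries_succ_eq h2 D k) ξ

end LocalRecursion

end Summit.Ventures.LatticeQCDFlow.Exactness

end
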